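import Mathlib
import Summits.AnomalousDissipation.AnomalousDissipation.Theorems.ConeDesingularisation.Negative.RadialCutoff

/-!
# Flux transfer V: from a constant smooth-cutoff flux to the sharp log-mean flux law

Part of the flux-transfer package for the crux `ConeDesingularisation ↔ CascadeSoliton`
(stmt-AnomalousDissipation-19034/19036, route `PointSink`); headline and overview in
`…/ConeDesingularisation/Negative/FedConeFlux.lean`.

`logMeanFlux_eq_of_constantSmoothFlux`: for a DSS pair `(V, Π)` (degrees `−2/3`, `−4/3`) with
`‖V‖³, |Π|^{3/2} ∈ L¹_loc(ℝ³∖0)`, a `c`-independent flux `τ` through the dilates `G(‖x‖²/c²)`,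
`c ∈ [1, λ]`, of one radial profile forces `∫_{1<‖x‖<λ} (½‖V‖² + Π) ⟪V, x⟫/‖x‖² = −τ log λ`
(Fubini average in `c`, inner integral in closed form, exact `λ⁻³`-covariance). [folklore]
-/

-- `Summit.<Summit>.<Problem>` is the tree's mandated summit-side namespace (CONVENTIONS §2).
set_option linter.dupNamespace false

noncomputable section

namespace Summit.AnomalousDissipation.AnomalousDissipation.Theorems.ConeDesingularisation.Negative

open MeasureTheory Filter Topology Set Metric
open scoped InnerProductSpace ContDiff
open Literature.Analysis.FluidPDE.EulerReynoldsLadder (isCompact_shell shell_subset_ne_zero)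

/-- `|½‖V‖² + Π| ‖V‖` is integrable on every closed shell `{a ≤ ‖x‖ ≤ b}`, `a > 0`, when
`‖V‖³, |Π|^{3/2} ∈ L¹_loc(ℝ³∖0)` (Hölder `(3, 3/2)`). [folklore] -/
theorem integrableOn_absHead_mul_norm {V : EuclideanSpace ℝ (Fin 3) → EuclideanSpace ℝ (Fin 3)} {Pc : EuclideanSpace ℝ (Fin 3) → ℝ}
    (hVm : AEStronglyMeasurable V volume) (hPcm : AEStronglyMeasurable Pc volume)
    (hV3 : LocallyIntegrableOn (fun x => ‖V x‖ ^ 3) {x : EuclideanSpace ℝ (Fin 3) | x ≠ 0} volume)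
    (hPc32 : LocallyIntegrableOn (fun x => |Pc x| ^ (3 / 2 : ℝ)) {x : EuclideanSpace ℝ (Fin 3) | x ≠ 0} volume) {a : ℝ}
    (ha : 0 < a) (b : ℝ) :
    IntegrableOn (fun x => |2⁻¹ * ‖V x‖ ^ 2 + Pc x| * ‖V x‖) {x : EuclideanSpace ℝ (Fin 3) | a ≤ ‖x‖ ∧ ‖x‖ ≤ b}
      volume := by
  set K := {x : EuclideanSpace ℝ (Fin 3) | a ≤ ‖x‖ ∧ ‖x‖ ≤ b}
  set μ : Measure (EuclideanSpace ℝ (Fin 3)) := volume.restrict K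
  have hv3 : Integrable (fun x => ‖V x‖ ^ 3) μ :=
    hV3.integrableOn_compact_subset (shell_subset_ne_zero ha b) (isCompact_shell a b)
  have hϖ : Integrable (fun x => |Pc x| ^ (3 / 2 : ℝ)) μ :=
    hPc32.integrableOn_compact_subset (shell_subset_ne_zero ha b) (isCompact_shell a b)
  have H := holder_three_threeHalves (μ := μ) (f := fun x => ‖V x‖) (g := fun x => |Pc x|)
    (fun x => norm_nonneg _) (fun x => abs_nonneg _) hVm.restrict.norm
    (continuous_abs.comp_aestronglyMeasurable hPcm.restrict) hv3 hϖ
  refine Integrable.mono' ((hv3.const_mul 2⁻¹).add H.1)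
    ((continuous_abs.comp_aestronglyMeasurable
      (((hVm.norm.pow 2).const_mul 2⁻¹).add hPcm).restrict).mul hVm.restrict.norm)
    (Eventually.of_forall fun x => ?_)
  rw [Real.norm_of_nonneg (by positivity)]
  show |2⁻¹ * ‖V x‖ ^ 2 + Pc x| * ‖V x‖ ≤ 2⁻¹ * ‖V x‖ ^ 3 + ‖V x‖ * |Pc x|
  have h1 : |2⁻¹ * ‖V x‖ ^ 2 + Pc x| ≤ 2⁻¹ * ‖V x‖ ^ 2 + |Pc x| :=
    (abs_add_le _ _).trans (by rw [abs_of_nonneg (by positivity : (0 : ℝ) ≤ 2⁻¹ * ‖V x‖ ^ 2)])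
  calc |2⁻¹ * ‖V x‖ ^ 2 + Pc x| * ‖V x‖ ≤ (2⁻¹ * ‖V x‖ ^ 2 + |Pc x|) * ‖V x‖ :=
        mul_le_mul_of_nonneg_right h1 (norm_nonneg _)
    _ = 2⁻¹ * ‖V x‖ ^ 3 + ‖V x‖ * |Pc x| := by ring

/-- **From a constant smooth-cutoff flux to the sharp log-mean flux law.** Let `(V, Π)` be
discretely self-similar (`V(λx) = λ^{-2/3} V x`, `Π(λx) = λ^{-4/3} Π x` off the origin, `λ > 1`)
with `‖V‖³, |Π|^{3/2} ∈ L¹_loc(ℝ³∖0)`, and let `G` be a smooth profile, `G = 1` below `r²`, `G = 0` above `b²` (`1 < r < b ≤ λ`). If the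
smooth-cutoff energy flux through every dilate `ψ_c(x) = G(‖x‖²/c²)`, `c ∈ [1, λ]`, has the same
value `τ`, i.e. `∫ (½‖V‖² + Π) Dψ_c[V] = τ`, then the sharp log-mean flux on the fundamental shell is
`∫_{1<‖x‖<λ} (½‖V‖² + Π) ⟪V, x⟫/‖x‖² = −τ log λ`.
Proof: average `c⁻¹ T(ψ_c) = c⁻¹ τ` over `c ∈ [1, λ]` (`= τ log λ`), swap the integrals (Fubini; the
integrand is dominated by `2λ²‖G'‖_∞ |½‖V‖²+Π| ‖V‖ 1_{1≤‖x‖≤λ²}`), evaluate the inner `c`-integral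
(`radial_inner_integral`: `∫_1^λ c⁻¹ G'(‖x‖²/c²) 2c⁻² dc = (ψ(x) − ψ(x/λ))/‖x‖²`) and finish with the
exact `λ⁻³`-covariance of `(½‖V‖²+Π)⟪V,x⟫/‖x‖²` (`shell_bookkeeping`). [folklore] -/
theorem logMeanFlux_eq_of_constantSmoothFlux {lam : ℝ} (hlam : 1 < lam) {V : EuclideanSpace ℝ (Fin 3) → EuclideanSpace ℝ (Fin 3)}
    {Pc : EuclideanSpace ℝ (Fin 3) → ℝ} (hVm : AEStronglyMeasurable V volume) (hPcm : AEStronglyMeasurable Pc volume)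
    (hV : ∀ x : EuclideanSpace ℝ (Fin 3), x ≠ 0 → V (lam • x) = lam ^ (-(2 / 3 : ℝ)) • V x)
    (hPc : ∀ x : EuclideanSpace ℝ (Fin 3), x ≠ 0 → Pc (lam • x) = lam ^ (-(4 / 3 : ℝ)) * Pc x)
    (hV3 : LocallyIntegrableOn (fun x => ‖V x‖ ^ 3) {x : EuclideanSpace ℝ (Fin 3) | x ≠ 0} volume)
    (hPc32 : LocallyIntegrableOn (fun x => |Pc x| ^ (3 / 2 : ℝ)) {x : EuclideanSpace ℝ (Fin 3) | x ≠ 0} volume)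
    {r b : ℝ} (hr : 1 < r) (hrb : r < b) (hb : b ≤ lam) {G : ℝ → ℝ} (hGs : ContDiff ℝ ∞ G)
    (hG1 : ∀ s, s ≤ r ^ 2 → G s = 1) (hG0 : ∀ s, b ^ 2 ≤ s → G s = 0) {τ : ℝ}
    (hT : ∀ c ∈ Icc 1 lam, ∫ x, (2⁻¹ * ‖V x‖ ^ 2 + Pc x) *
      (deriv G (‖x‖ ^ 2 / c ^ 2) * ((c ^ 2)⁻¹ * (2 * ⟪x, V x⟫_ℝ))) = τ) :
    ∫ x in {x : EuclideanSpace ℝ (Fin 3) | 1 < ‖x‖ ∧ ‖x‖ < lam}, (2⁻¹ * ‖V x‖ ^ 2 + Pc x) * (⟪V x, x⟫_ℝ / ‖x‖ ^ 2) =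
      -(τ * Real.log lam) := by
  have hlam0 : 0 < lam := one_pos.trans hlam
  have hb0 : 0 < b := by linarith
  have hG'c : Continuous (deriv G) := hGs.continuous_deriv (by simp)
  have hG'0 : ∀ s, s ∉ Icc (r ^ 2) (b ^ 2) → deriv G s = 0 := fun s hs =>
    deriv_eq_zero_of_profile hG1 hG0 hs
  have hG'cs : HasCompactSupport (deriv G) :=
    HasCompactSupport.of_support_subset_isCompact isCompact_Icc fun s hs => by
      by_contra h
      exact hs (hG'0 s h)
  obtain ⟨M, hM⟩ := hG'c.bounded_above_of_compact_support hG'cs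
  have hM0 : 0 ≤ M := (norm_nonneg _).trans (hM 0)
  set H : EuclideanSpace ℝ (Fin 3) → ℝ := fun x => 2⁻¹ * ‖V x‖ ^ 2 + Pc x with hH
  have hHm : AEStronglyMeasurable H volume := ((hVm.norm.pow 2).const_mul 2⁻¹).add hPcm
  set A' := {x : EuclideanSpace ℝ (Fin 3) | 1 ≤ ‖x‖ ∧ ‖x‖ ≤ lam ^ 2} with hA'
  have hA'm : MeasurableSet A' := (isCompact_shell 1 (lam ^ 2)).measurableSet
  have hHV : IntegrableOn (fun x => |H x| * ‖V x‖) A' volume :=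
    integrableOn_absHead_mul_norm hVm hPcm hV3 hPc32 one_pos _
  set Φ : ℝ → EuclideanSpace ℝ (Fin 3) → ℝ := fun c x =>
    c⁻¹ * (H x * (deriv G (‖x‖ ^ 2 / c ^ 2) * ((c ^ 2)⁻¹ * (2 * ⟪x, V x⟫_ℝ)))) with hΦ
  -- (i) localisation: if `G'(‖x‖²/c²) ≠ 0` for some `c ∈ [1, λ]` then `x ∈ A'`
  have hsupp : ∀ c ∈ Icc 1 lam, ∀ x : EuclideanSpace ℝ (Fin 3), deriv G (‖x‖ ^ 2 / c ^ 2) ≠ 0 → x ∈ A' := by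
    intro c hc x hx
    have hc0 : 0 < c := one_pos.trans_le hc.1
    have hmem : ‖x‖ ^ 2 / c ^ 2 ∈ Icc (r ^ 2) (b ^ 2) := by
      by_contra h
      exact hx (hG'0 _ h)
    rw [mem_Icc, le_div_iff₀ (by positivity), div_le_iff₀ (by positivity)] at hmem
    have hlo : 1 ≤ ‖x‖ ^ 2 := by
      have h1 : 1 ≤ r ^ 2 * c ^ 2 :=
        one_le_mul_of_one_le_of_one_le (by nlinarith [hr]) (by nlinarith [hc.1])
      exact h1.trans hmem.1
    have hhi : ‖x‖ ^ 2 ≤ (lam ^ 2) ^ 2 := hmem.2.trans (by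
      calc b ^ 2 * c ^ 2 = (b * c) ^ 2 := by ring
        _ ≤ (lam * lam) ^ 2 :=
          pow_le_pow_left₀ (by positivity) (mul_le_mul hb hc.2 hc0.le hlam0.le) 2
        _ = (lam ^ 2) ^ 2 := by ring)
    exact ⟨by nlinarith [norm_nonneg x],
      (pow_le_pow_iff_left₀ (norm_nonneg x) (by positivity) two_ne_zero).1 hhi⟩
  -- (ii) domination, uniformly in `c ∈ [1, λ]`
  have hbound : ∀ c ∈ Icc 1 lam, ∀ x : EuclideanSpace ℝ (Fin 3),
      ‖Φ c x‖ ≤ 1 * ((2 * lam ^ 2 * M) * A'.indicator (fun x => |H x| * ‖V x‖) x) := by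
    intro c hc x
    have hc0 : 0 < c := one_pos.trans_le hc.1
    rw [one_mul, Real.norm_eq_abs]
    by_cases hx : deriv G (‖x‖ ^ 2 / c ^ 2) = 0
    · simp only [hΦ, hx, zero_mul, mul_zero, abs_zero]
      exact mul_nonneg (by positivity) (Set.indicator_nonneg (fun y _ => by positivity) _)
    · have hxA := hsupp c hc x hx
      rw [Set.indicator_of_mem hxA]
      have hci : c⁻¹ ≤ 1 := inv_le_one_of_one_le₀ hc.1
      have hc2i : (c ^ 2)⁻¹ ≤ 1 := inv_le_one_of_one_le₀ (one_le_pow₀ hc.1)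
      have hin : |⟪x, V x⟫_ℝ| ≤ ‖x‖ * ‖V x‖ := abs_real_inner_le_norm _ _
      have hxn : ‖x‖ ≤ lam ^ 2 := hxA.2
      have hMx : |deriv G (‖x‖ ^ 2 / c ^ 2)| ≤ M := (Real.norm_eq_abs _).symm.le.trans (hM _)
      have hexp : |Φ c x| = c⁻¹ * (|H x| * (|deriv G (‖x‖ ^ 2 / c ^ 2)| *
          ((c ^ 2)⁻¹ * (2 * |⟪x, V x⟫_ℝ|)))) := by
        simp only [hΦ, abs_mul, abs_inv, abs_of_pos hc0, abs_of_pos (pow_pos hc0 2), abs_two]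
      rw [hexp]
      calc c⁻¹ * (|H x| * (|deriv G (‖x‖ ^ 2 / c ^ 2)| * ((c ^ 2)⁻¹ * (2 * |⟪x, V x⟫_ℝ|))))
          ≤ 1 * (|H x| * (M * (1 * (2 * (‖x‖ * ‖V x‖))))) := by gcongr
        _ = (2 * M * (|H x| * ‖V x‖)) * ‖x‖ := by ring
        _ ≤ (2 * M * (|H x| * ‖V x‖)) * lam ^ 2 :=
          mul_le_mul_of_nonneg_left hxn (by positivity)
        _ = 2 * lam ^ 2 * M * (|H x| * ‖V x‖) := by ring
  -- (iii) integrability on the product `[1, λ] × ℝ³`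
  have hΦm : AEStronglyMeasurable (Function.uncurry Φ)
      ((volume.restrict (Icc 1 lam)).prod (volume : Measure (EuclideanSpace ℝ (Fin 3)))) := by
    have m1 : Measurable (fun z : ℝ × (EuclideanSpace ℝ (Fin 3)) => z.1⁻¹) := measurable_fst.inv
    have m2 : AEStronglyMeasurable (fun z : ℝ × (EuclideanSpace ℝ (Fin 3)) => H z.2)
        ((volume.restrict (Icc 1 lam)).prod (volume : Measure (EuclideanSpace ℝ (Fin 3)))) := hHm.comp_snd
    have m3 : Measurable (fun z : ℝ × (EuclideanSpace ℝ (Fin 3)) => deriv G (‖z.2‖ ^ 2 / z.1 ^ 2)) :=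
      hG'c.measurable.comp ((measurable_snd.norm.pow_const 2).div (measurable_fst.pow_const 2))
    have m4 : Measurable (fun z : ℝ × (EuclideanSpace ℝ (Fin 3)) => (z.1 ^ 2)⁻¹) := (measurable_fst.pow_const 2).inv
    have m5 : AEStronglyMeasurable (fun z : ℝ × (EuclideanSpace ℝ (Fin 3)) => ⟪z.2, V z.2⟫_ℝ)
        ((volume.restrict (Icc 1 lam)).prod (volume : Measure (EuclideanSpace ℝ (Fin 3)))) :=
      measurable_snd.aestronglyMeasurable.inner hVm.comp_snd
    exact m1.aestronglyMeasurable.mul (m2.mul (m3.aestronglyMeasurable.mul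
      (m4.aestronglyMeasurable.mul (m5.const_mul 2))))
  have hae : ∀ᵐ z ∂((volume.restrict (Icc 1 lam)).prod (volume : Measure (EuclideanSpace ℝ (Fin 3)))), z.1 ∈ Icc 1 lam := by
    rw [ae_iff]
    have hset : {z : ℝ × (EuclideanSpace ℝ (Fin 3)) | ¬z.1 ∈ Icc 1 lam} = (Icc 1 lam)ᶜ ×ˢ (univ : Set (EuclideanSpace ℝ (Fin 3))) := by
      ext z
      simp only [Set.mem_setOf_eq, Set.mem_prod, Set.mem_compl_iff, Set.mem_univ, and_true]
    rw [hset, Measure.prod_prod, Measure.restrict_apply measurableSet_Icc.compl,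
      Set.compl_inter_self, measure_empty, zero_mul]
  have hΦint : Integrable (Function.uncurry Φ)
      ((volume.restrict (Icc 1 lam)).prod (volume : Measure (EuclideanSpace ℝ (Fin 3)))) := by
    refine Integrable.mono' ((integrable_const (1 : ℝ)).mul_prod
      ((hHV.integrable_indicator hA'm).const_mul (2 * lam ^ 2 * M))) hΦm ?_
    filter_upwards [hae] with z hz using hbound z.1 hz z.2
  -- (iv) Fubini
  have hswap := integral_integral_swap hΦint
  -- (v) the `c`-side: `∫_{[1,λ]} c⁻¹ τ dc = τ log λ`
  have hL : ∫ c in Icc 1 lam, ∫ x, Φ c x = τ * Real.log lam := by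
    have e : ∀ c ∈ Icc 1 lam, ∫ x, Φ c x = c⁻¹ * τ := fun c hc => by
      simp only [hΦ]
      rw [integral_const_mul, hT c hc]
    rw [setIntegral_congr_fun measurableSet_Icc e, integral_mul_const, integral_Icc_eq_integral_Ioc,
      ← intervalIntegral.integral_of_le hlam.le, integral_inv_of_pos one_pos hlam0, div_one, mul_comm]
  -- (vi) the `x`-side: the inner integral is `(ψ(x) − ψ(x/λ)) · (½‖V‖²+Π)⟪V,x⟫/‖x‖²`
  set fV : EuclideanSpace ℝ (Fin 3) → ℝ := fun x => H x * (⟪V x, x⟫_ℝ / ‖x‖ ^ 2) with hfV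
  have hinner : ∀ x, ∫ c in Icc 1 lam, Φ c x = (G (‖x‖ ^ 2) - G (‖x‖ ^ 2 / lam ^ 2)) * fV x := by
    intro x
    have e : ∀ c, Φ c x = (c⁻¹ * (deriv G (‖x‖ ^ 2 / c ^ 2) * ((c ^ 2)⁻¹ * 2))) *
        (H x * ⟪V x, x⟫_ℝ) := fun c => by
      simp only [hΦ, real_inner_comm (V x) x]
      ring
    simp_rw [e]
    rw [integral_mul_const]
    by_cases hx : x = 0
    · subst hx
      simp [hfV]
    · rw [radial_inner_integral hGs (by positivity : 0 < ‖x‖ ^ 2) hlam.le, hfV]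
      have hx2 : ‖x‖ ^ 2 ≠ 0 := by positivity
      field_simp
  -- (vii) properties of `fV` for the shell bookkeeping
  have hfVm : AEStronglyMeasurable fV volume :=
    (hHm.aemeasurable.mul ((hVm.aemeasurable.inner aemeasurable_id).div
      (measurable_norm.pow_const 2).aemeasurable)).aestronglyMeasurable
  have hfVi : IntegrableOn fV A' volume := by
    refine Integrable.mono' hHV hfVm.restrict ((ae_restrict_mem hA'm).mono fun x hx => ?_)
    rw [Real.norm_eq_abs, hfV]
    simp only
    have hx1 : 1 ≤ ‖x‖ := hx.1
    rw [abs_mul, abs_div, abs_of_nonneg (by positivity : (0 : ℝ) ≤ ‖x‖ ^ 2)]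
    refine mul_le_mul_of_nonneg_left ?_ (abs_nonneg _)
    rw [div_le_iff₀ (by positivity)]
    calc |⟪V x, x⟫_ℝ| ≤ ‖V x‖ * ‖x‖ := abs_real_inner_le_norm _ _
      _ ≤ ‖V x‖ * ‖x‖ ^ 2 := by
        refine mul_le_mul_of_nonneg_left ?_ (norm_nonneg _)
        nlinarith
  have hsc : ∀ y : EuclideanSpace ℝ (Fin 3), y ≠ 0 → fV (lam • y) = (lam ^ 3)⁻¹ * fV y := by
    intro y hy0
    set a : ℝ := lam ^ (-(2 / 3 : ℝ)) with ha
    have ha0 : 0 < a := Real.rpow_pos_of_pos hlam0 _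
    have e1 : lam ^ (-(4 / 3 : ℝ)) = a ^ 2 := by
      rw [ha, ← Real.rpow_natCast, ← Real.rpow_mul hlam0.le]; norm_num
    have e3 : a ^ 3 = (lam ^ 2)⁻¹ := by
      rw [ha, ← Real.rpow_natCast, ← Real.rpow_mul hlam0.le, ← Real.rpow_two,
        ← Real.rpow_neg hlam0.le]
      norm_num
    have e4 : (lam ^ 3)⁻¹ = a ^ 3 / lam := by
      rw [e3]
      field_simp
    simp only [hfV, hH]
    rw [hV y hy0, hPc y hy0, e1, e4, norm_smul, norm_smul, Real.norm_eq_abs, Real.norm_eq_abs,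
      abs_of_pos ha0, abs_of_pos hlam0, real_inner_smul_left, real_inner_smul_right]
    have hy2 : ‖y‖ ≠ 0 := norm_ne_zero_iff.2 hy0
    field_simp
  have hbook := shell_bookkeeping hlam hfVi hsc hGs.continuous hr hb0 hb hG1 hG0
  -- (viii) assemble
  have key : τ * Real.log lam = -∫ x in {x : EuclideanSpace ℝ (Fin 3) | 1 < ‖x‖ ∧ ‖x‖ < lam}, fV x := by
    rw [← hL, hswap, integral_congr_ae (ae_of_all _ hinner), hbook]
  linarith [key]

end Summit.AnomalousDissipation.AnomalousDissipation.Theorems.ConeDesingularisation.Negative
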